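import Summits.CriticalPhenomena.PercolationContinuityZ3.Theorems.PercNearOneGluingNoHeavyLowerTailKnQuestion8CoefficientwiseTrivialCoreFlip
import HarnessLib

/-!
# THEOREM TC, part 1: the classes of the trivial-core stratum (component flips at `z` × free recolourings)

Support file (`--supports stmt-CriticalPhenomena-4575`, closed), prover `prim-cplus-coupling` (gen 29).  No definitions, no named facts, no sorries;
standard axioms.  Memo `prim-cplus-coupling/A5-COUPLING-gen28.md` §2.6 and `A5-COUPLING-gen29.md`; tools `…CoefficientwiseTrivialCoreFlip.lean`;
the component calculus is prim-lf-2's `…CoefficientwiseComponentFlip/ComponentCube.lean` (THEOREM CC), used here with ROOT `z`; the theorem itself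
(GRAND on the trivial-core stratum) is the companion `…CoefficientwiseTrivialCore.lean`.

Setting.  A finite multigraph `ends : ι → Sym2 V`, an edge set `E₀`, colourings `s ⊆ E₀` (red) / `E₀ \ s` (blue); `C_v(s) = openCluster (ends '' s) v`;
the zone of `z` is `U = C_z(s) ∪ C_z(E₀∖s)`, its components (`Comps`, clusters for the edges inside `U ∖ {z}`) are prim-lf-2's, with root `z`;
on the TRIVIAL-CORE STRATUM `C_z(s) ∩ C_z(E₀∖s) = {z}` every component lies in one cluster of `z` (`RS` = the red-side ones).  The FREE edges `Fr`
are the edges of `E₀` all of whose ends in `U` equal `z` (they meet no component).  The class of `s` consists of the colourings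
`FL[s, J, A] = (s ∆ I[⋃J]) ∆ A` (`J ⊆ Comps`, `A ⊆ Fr`; `I[W]` = edges meeting `W`).  This file proves:
* `Coefficientwise.flipFree_facts` — `FL[s,J,A]` stays in `E₀`, on the stratum and in the class data: same `U`, `Comps`, `Fr`; red side `RS ∆ J`;
  red free edges `(s ∩ Fr) ∆ A` (prim-lf-2's `cc_flip`, `union_flip_eq`, `side_flip_eq` + free-edge invariance);
* `Coefficientwise.sdiff_flipFree` — **the class is closed under the colour swap, which is its antipode**: `E₀ \ FL[s,J,A] = FL[s, Comps∖J, Fr∖A]`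
  (every edge of `E₀` is free or meets exactly one component);
* `Coefficientwise.flipFree_mono` — **the cluster quadruple is grand-monotone along the class**: if the red side of `z` shrinks and the red free edges
  grow, then `C_x` grows, `C_x(E₀∖·)` shrinks, `C_z` shrinks, `C_z(E₀∖·)` grows (CONFINEMENT `openCluster_subset_sdiff_incident`: a red path from `x`
  never touches the red side of `z`; and `C_z = {z} ∪ ⋃ RS`).
[cite: KozmaNitzan2024, Questions 8–9 (§5.5 p. 36) (context: the Question-8 pocket covariance programme)]
-/

namespace Summit.CriticalPhenomena.PercolationContinuityZ3.Theorems

open Finset Literature.Probability.Percolation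
open scoped symmDiff

namespace Coefficientwise

variable {ι V : Type*} (ends : ι → Sym2 V) (E₀ : Finset ι) (x z : V) (Vf : Finset V)

set_option quotPrecheck false in
/-- red cluster of `z` -/
local notation "Cz[" s "]" => openCluster (ends '' (↑(s : Finset ι) : Set ι)) z
set_option quotPrecheck false in
/-- red cluster of `x` -/
local notation "Cx[" s "]" => openCluster (ends '' (↑(s : Finset ι) : Set ι)) x
set_option quotPrecheck false in
/-- the zone of `z`: `U = C_z(s) ∪ C_z(E₀ \ s)` -/
local notation "U[" s "]" => (openCluster (ends '' (↑(s : Finset ι) : Set ι)) z ∪ openCluster (ends '' (↑(E₀ \ s : Finset ι) : Set ι)) z)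
set_option quotPrecheck false in
/-- the component of `v` (root `z`) -/
local notation "Cmp[" s "," v "]" =>
  openCluster (ends '' (↑(E₀.filter (fun i => ∀ y ∈ ends i, y ∈ U[s] ∧ y ≠ z)) : Set ι)) v
set_option quotPrecheck false in
/-- the component of `v` as a finset -/
local notation "CmpF[" s "," v "]" => (Vf.filter (fun y : V => y ∈ Cmp[s, v]))
set_option quotPrecheck false in
/-- the finset of components of `U \ {z}` -/
local notation "Comps[" s "]" => ((Vf.filter (fun v : V => v ∈ U[s] ∧ v ≠ z)).image (fun v : V => CmpF[s, v]))
set_option quotPrecheck false in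
/-- the red-side components -/
local notation "RS[" s "]" => ((Comps[s]).filter (fun C : Finset V => (↑C : Set V) ⊆ Cz[s]))
set_option quotPrecheck false in
/-- the edges of `E₀` incident to a vertex set `W` -/
local notation "I[" W "]" => (@Finset.filter ι (fun i => ∃ w, w ∈ (W : Set V) ∧ w ∈ ends i) (fun _ => Classical.propDecidable _) E₀)
set_option quotPrecheck false in
/-- the free edges: those of `E₀` all of whose ends in the zone equal `z` -/
local notation "Fr[" s "]" => (E₀.filter (fun i => ∀ w ∈ ends i, w ∈ U[s] → w = z))
set_option quotPrecheck false in
/-- the colouring with the components `J` flipped and the free edges `A` recoloured -/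
local notation "FL[" s "," J "," A "]" => (((s : Finset ι) ∆ I[(↑((J : Finset (Finset V)).biUnion id) : Set V)]) ∆ (A : Finset ι))
set_option quotPrecheck false in
/-- trivial core: the two clusters of `z` meet only in `z` -/
local notation "TC[" s "]" => (∀ y, y ∈ Cz[s] → y ∈ Cz[E₀ \ s] → y = z)

open Classical in
/-- On a colouring of `E₀`, the free edges avoid every component (`I[⋃ J] ∩ Fr = ∅`): an edge meeting a component meets `U \ {z}`.
[cite: KozmaNitzan2024, §5.5 (context only; folklore)] -/
theorem not_mem_free_of_mem_incident {s : Finset ι} {J : Finset (Finset V)} (hJ : J ⊆ Comps[s]) (W : Set V)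
    (hW : W = (↑(J.biUnion id) : Set V)) {i : ι} (hi : i ∈ I[W]) : i ∉ Fr[s] := by
  intro hiF
  rw [Finset.mem_filter] at hi hiF
  obtain ⟨-, w, hw, hwi⟩ := hi
  rw [hW, Finset.mem_coe, Finset.mem_biUnion] at hw
  obtain ⟨C, hCJ, hwC⟩ := hw
  obtain ⟨hwU, hwz⟩ := comps_sub ends E₀ z Vf (hJ hCJ) hwC
  exact hwz (hiF.2 w hwi hwU)

open Classical in
/-- Membership in `I[⋃ J]`. [cite: KozmaNitzan2024, §5.5 (context only)] -/
theorem mem_incident_biUnion_iff {J : Finset (Finset V)} (W : Set V) (hW : W = (↑(J.biUnion id) : Set V)) {i : ι} :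
    i ∈ I[W] ↔ i ∈ E₀ ∧ ∃ C ∈ J, ∃ w ∈ C, w ∈ ends i := by
  rw [Finset.mem_filter]
  constructor
  · rintro ⟨hiE, w, hw, hwi⟩
    rw [hW, Finset.mem_coe, Finset.mem_biUnion] at hw
    obtain ⟨C, hCJ, hwC⟩ := hw
    exact ⟨hiE, C, hCJ, w, hwC, hwi⟩
  · rintro ⟨hiE, C, hCJ, w, hwC, hwi⟩
    refine ⟨hiE, w, ?_, hwi⟩
    rw [hW, Finset.mem_coe, Finset.mem_biUnion]
    exact ⟨C, hCJ, hwC⟩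

open Classical in
/-- **Class bookkeeping.**  For `s ⊆ E₀` on the trivial-core stratum, `J ⊆ Comps[s]` and `A ⊆ Fr[s]`, the colouring `c = FL[s, J, A]` satisfies:
`c ⊆ E₀`, `C_z(c) = C_z(s ∆ I[⋃J])`, `C_z(E₀∖c) = C_z(E₀ ∖ (s ∆ I[⋃J]))`, hence `U[c] = U[s]`, `TC[c]`, `Comps[c] = Comps[s]`, `Fr[c] = Fr[s]`,
`RS[c] = RS[s] ∆ J`, and `c ∩ Fr[s] = (s ∩ Fr[s]) ∆ A`. [cite: KozmaNitzan2024, §5.5 (context only; folklore)] -/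
theorem flipFree_facts (hVf : ∀ i ∈ E₀, ∀ y ∈ ends i, y ∈ Vf) {s : Finset ι} (hs : s ⊆ E₀) (hTC : TC[s])
    {J : Finset (Finset V)} (hJ : J ⊆ Comps[s]) {A : Finset ι} (hA : A ⊆ Fr[s]) :
    FL[s, J, A] ⊆ E₀ ∧
    Cz[FL[s, J, A]] = Cz[s ∆ I[(↑(J.biUnion id) : Set V)]] ∧
    Cz[E₀ \ FL[s, J, A]] = Cz[E₀ \ (s ∆ I[(↑(J.biUnion id) : Set V)])] ∧
    U[FL[s, J, A]] = U[s] ∧ TC[FL[s, J, A]] ∧ Comps[FL[s, J, A]] = Comps[s] ∧ Fr[FL[s, J, A]] = Fr[s] ∧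
    RS[FL[s, J, A]] = RS[s] ∆ J ∧ FL[s, J, A] ∩ Fr[s] = (s ∩ Fr[s]) ∆ A := by
  set W : Set V := (↑(J.biUnion id) : Set V) with hW
  set s₁ : Finset ι := s ∆ I[W] with hs₁
  have hAE : A ⊆ E₀ := fun i hi => (Finset.mem_filter.mp (hA hi)).1
  have hs₁E : s₁ ⊆ E₀ := flip_subset ends E₀ (s := s) hs W
  have hU₁ : U[s₁] = U[s] := union_flip_eq ends E₀ z Vf hVf (s := s) hs hTC (J := J) hJ W hW
  have hTC₁ : TC[s₁] := cc_flip ends E₀ z Vf hVf (s := s) hs hTC (J := J) hJ W hW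
  have hfree : ∀ i ∈ A, ∀ w ∈ ends i, (w ∈ Cz[s₁] ∨ w ∈ Cz[E₀ \ s₁]) → w = z := by
    intro i hi w hw hwU
    have hwU' : w ∈ U[s] := by rw [← hU₁]; exact hwU
    exact (Finset.mem_filter.mp (hA hi)).2 w hw hwU'
  have hcE : FL[s, J, A] ⊆ E₀ := by
    intro i hi
    rcases Finset.mem_symmDiff.mp hi with ⟨h, -⟩ | ⟨h, -⟩
    · exact hs₁E h
    · exact hAE h
  have hZR : Cz[FL[s, J, A]] = Cz[s₁] := openCluster_symmDiff_free ends E₀ s₁ A z hAE hfree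
  have hZB : Cz[E₀ \ FL[s, J, A]] = Cz[E₀ \ s₁] := openCluster_sdiff_symmDiff_free ends E₀ s₁ A z hs₁E hAE hfree
  have hU : U[FL[s, J, A]] = U[s] := by rw [hZR, hZB]; exact hU₁
  have hTCc : TC[FL[s, J, A]] := by
    intro y hy1 hy2
    rw [hZR] at hy1; rw [hZB] at hy2
    exact hTC₁ y hy1 hy2
  have hComps : Comps[FL[s, J, A]] = Comps[s] := comps_congr ends E₀ z Vf hU
  have hFr : Fr[FL[s, J, A]] = Fr[s] := by rw [hU]
  have hRS : RS[FL[s, J, A]] = RS[s] ∆ J := by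
    have h := side_flip_eq ends E₀ z Vf hVf (s := s) hs hTC (J := J) hJ W hW
    have hComps₁ : Comps[s₁] = Comps[s] := comps_congr ends E₀ z Vf hU₁
    rw [hComps, hZR]
    rw [hComps₁] at h
    exact h
  have hcap : FL[s, J, A] ∩ Fr[s] = (s ∩ Fr[s]) ∆ A := by
    ext i
    have h1 : i ∈ I[W] → i ∉ Fr[s] := fun h => not_mem_free_of_mem_incident ends E₀ z Vf hJ W hW h
    have h2 : i ∈ A → i ∈ Fr[s] := fun h => hA h
    simp only [Finset.mem_inter, Finset.mem_symmDiff]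
    tauto
  exact ⟨hcE, hZR, hZB, hU, hTCc, hComps, hFr, hRS, hcap⟩


open Classical in
/-- Components are nonempty. [cite: KozmaNitzan2024, §5.5 (context only; folklore)] -/
theorem comps_nonempty {s : Finset ι} {C : Finset V} (hC : C ∈ Comps[s]) : ∃ y, y ∈ C := by
  rw [Finset.mem_image] at hC
  obtain ⟨v, hv, rfl⟩ := hC
  refine ⟨v, ?_⟩
  rw [Finset.mem_filter]
  exact ⟨(Finset.mem_filter.mp hv).1, mem_openCluster_self _ _⟩

/-- Propositional bookkeeping for `sdiff_flipFree`: with atoms `S = (i ∈ s)`, `W = (i meets ⋃J)`, `A = (i ∈ A)`, `W' = (i meets ⋃(Comps∖J))`,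
`F = (i free)`, the facts "`A → F`, free edges meet no component, a non-free edge meets `⋃J` or `⋃(Comps∖J)` but not both" give
`¬(S ⊕ W ⊕ A) ↔ S ⊕ W' ⊕ (F ∧ ¬A)`. [cite: KozmaNitzan2024, §5.5 (context only)] -/
theorem xor_trichotomy_aux (S W A W' F : Prop) (h1 : A → F) (h2 : F → ¬W) (h3 : F → ¬W') (h4 : ¬F → W ∨ W') (h5 : W → W' → False) :
    ¬ Xor (Xor S W) A ↔ Xor (Xor S W') (F ∧ ¬A) := by
  by_cases hS : S <;> by_cases hW : W <;> by_cases hA : A <;> by_cases hW' : W' <;> by_cases hF : F <;> simp_all [Xor]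

open Classical in
/-- **The class is closed under the colour swap, which is its antipode**: for `s ⊆ E₀`, `J ⊆ Comps[s]`, `A ⊆ Fr[s]`,
`E₀ \ FL[s, J, A] = FL[s, Comps[s] \ J, Fr[s] \ A]` (every edge of `E₀` meets exactly one component or is free).
[cite: KozmaNitzan2024, §5.5 (context only; folklore)] -/
theorem sdiff_flipFree (hVf : ∀ i ∈ E₀, ∀ y ∈ ends i, y ∈ Vf) {s : Finset ι} (hs : s ⊆ E₀)
    {J : Finset (Finset V)} (hJ : J ⊆ Comps[s]) {A : Finset ι} (hA : A ⊆ Fr[s]) :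
    E₀ \ FL[s, J, A] = FL[s, Comps[s] \ J, Fr[s] \ A] := by
  set W : Set V := (↑(J.biUnion id) : Set V) with hW
  set W' : Set V := (↑((Comps[s] \ J).biUnion id) : Set V) with hW'
  have hJ' : Comps[s] \ J ⊆ Comps[s] := Finset.sdiff_subset
  have cover : ∀ i ∈ E₀, i ∉ Fr[s] → i ∈ I[W] ∨ i ∈ I[W'] := by
    intro i hiE hiF
    have h : ¬ ∀ w ∈ ends i, w ∈ U[s] → w = z := fun h => hiF (Finset.mem_filter.mpr ⟨hiE, h⟩)
    push Not at h
    obtain ⟨w, hwi, hwU, hwz⟩ := h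
    obtain ⟨hC, hwC⟩ := comps_cover ends E₀ z Vf hVf hs hwU hwz
    by_cases hCJ : CmpF[s, w] ∈ J
    · exact Or.inl ((mem_incident_biUnion_iff ends E₀ W hW).mpr ⟨hiE, _, hCJ, w, hwC, hwi⟩)
    · exact Or.inr ((mem_incident_biUnion_iff ends E₀ W' hW').mpr ⟨hiE, _, Finset.mem_sdiff.mpr ⟨hC, hCJ⟩, w, hwC, hwi⟩)
  have excl : ∀ i, i ∈ I[W] → i ∈ I[W'] → False := by
    intro i h1 h2
    obtain ⟨hiE, C₁, hC₁J, w₁, hw₁C, hw₁i⟩ := (mem_incident_biUnion_iff ends E₀ W hW).mp h1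
    obtain ⟨-, C₂, hC₂J, w₂, hw₂C, hw₂i⟩ := (mem_incident_biUnion_iff ends E₀ W' hW').mp h2
    have hC₁ : C₁ ∈ Comps[s] := hJ hC₁J
    obtain ⟨hC₂, hC₂nJ⟩ := Finset.mem_sdiff.mp hC₂J
    have hne : C₁ ≠ C₂ := fun h => hC₂nJ (h ▸ hC₁J)
    have he : ends i = s(w₁, Sym2.Mem.other hw₁i) := (Sym2.other_spec hw₁i).symm
    rw [he, Sym2.mem_iff] at hw₂i
    rcases hw₂i with h12 | h12
    · subst h12
      exact hne ((comps_eq_of_mem ends E₀ z Vf hC₁ hw₁C).trans (comps_eq_of_mem ends E₀ z Vf hC₂ hw₂C).symm)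
    · obtain ⟨hw₂U, hw₂z⟩ := comps_sub ends E₀ z Vf hC₂ hw₂C
      have hw₂C₁ : w₂ ∈ C₁ := comps_closed ends E₀ z Vf hVf hC₁ hw₁C hiE (h12 ▸ he) hw₂U hw₂z
      exact hne ((comps_eq_of_mem ends E₀ z Vf hC₁ hw₂C₁).trans (comps_eq_of_mem ends E₀ z Vf hC₂ hw₂C).symm)
  ext i
  have f1 : i ∈ I[W] → i ∉ Fr[s] := fun h => not_mem_free_of_mem_incident ends E₀ z Vf hJ W hW h
  have f2 : i ∈ I[W'] → i ∉ Fr[s] := fun h => not_mem_free_of_mem_incident ends E₀ z Vf hJ' W' hW' h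
  have f3 : i ∈ A → i ∈ Fr[s] := fun h => hA h
  by_cases hiE : i ∈ E₀
  · have e1 : i ∈ FL[s, J, A] ↔ Xor (Xor (i ∈ s) (i ∈ I[W])) (i ∈ A) := by
      rw [Finset.mem_symmDiff, Finset.mem_symmDiff]
      exact Iff.rfl
    have e2 : i ∈ FL[s, Comps[s] \ J, Fr[s] \ A] ↔ Xor (Xor (i ∈ s) (i ∈ I[W'])) (i ∈ Fr[s] ∧ i ∉ A) := by
      rw [Finset.mem_symmDiff, Finset.mem_symmDiff, Finset.mem_sdiff]
      exact Iff.rfl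
    rw [Finset.mem_sdiff, e1, e2, and_iff_right hiE]
    exact xor_trichotomy_aux _ _ _ _ _ f3 (fun hF hW1 => f1 hW1 hF) (fun hF hW2 => f2 hW2 hF) (cover i hiE) (excl i)
  · constructor
    · intro h
      exact absurd (Finset.mem_sdiff.mp h).1 hiE
    · intro h
      exfalso
      rcases Finset.mem_symmDiff.mp h with ⟨h1, -⟩ | ⟨h1, -⟩
      · rcases Finset.mem_symmDiff.mp h1 with ⟨h2, -⟩ | ⟨h2, -⟩
        · exact hiE (hs h2)
        · exact hiE ((mem_incident_biUnion_iff ends E₀ W' hW').mp h2).1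
      · exact hiE (Finset.mem_filter.mp (Finset.mem_sdiff.mp h1).1).1

open Classical in
/-- **Monotonicity of the cluster quadruple along a class.**  Let `s ⊆ E₀` lie on the trivial-core stratum with `x` outside the zone, and let
`c = FL[s, J, A]`, `c' = FL[s, J', A']` be two members of its class such that the red side of `z` SHRINKS (`RS ∆ J' ⊆ RS ∆ J`) and the red free edges
GROW (`(s ∩ Fr) ∆ A ⊆ (s ∩ Fr) ∆ A'`).  Then `C_x` grows, `C_x(E₀ ∖ ·)` shrinks, `C_z` shrinks and `C_z(E₀ ∖ ·)` grows: the quadruple increases in the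
grand order.  (Confinement for the `x`-clusters; the component description of the `z`-clusters.) [cite: KozmaNitzan2024, §5.5 (context only)] -/
theorem flipFree_mono (hVf : ∀ i ∈ E₀, ∀ y ∈ ends i, y ∈ Vf) {s : Finset ι} (hs : s ⊆ E₀) (hTC : TC[s]) (hxU : x ∉ U[s])
    {J J' : Finset (Finset V)} (hJ : J ⊆ Comps[s]) (hJ' : J' ⊆ Comps[s]) {A A' : Finset ι} (hA : A ⊆ Fr[s]) (hA' : A' ⊆ Fr[s])
    (hred : RS[s] ∆ J' ⊆ RS[s] ∆ J) (hfr : (s ∩ Fr[s]) ∆ A ⊆ (s ∩ Fr[s]) ∆ A') :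
    Cx[FL[s, J, A]] ⊆ Cx[FL[s, J', A']] ∧ Cx[E₀ \ FL[s, J', A']] ⊆ Cx[E₀ \ FL[s, J, A]] ∧
    Cz[FL[s, J', A']] ⊆ Cz[FL[s, J, A]] ∧ Cz[E₀ \ FL[s, J, A]] ⊆ Cz[E₀ \ FL[s, J', A']] := by
  obtain ⟨hcE, -, -, hU, hTCc, hComps, -, hRS, hcap⟩ := flipFree_facts ends E₀ z Vf hVf hs hTC hJ hA
  obtain ⟨hcE', -, -, hU', hTCc', hComps', -, hRS', hcap'⟩ := flipFree_facts ends E₀ z Vf hVf hs hTC hJ' hA'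
  set c : Finset ι := FL[s, J, A] with hc
  set c' : Finset ι := FL[s, J', A'] with hc'
  obtain ⟨WN, hWN⟩ : ∃ WN : Set V, WN = (↑((J ∆ J').biUnion id) : Set V) := ⟨_, rfl⟩
  -- the components whose side differs are red in `c` and blue in `c'`
  have hN : ∀ C ∈ J ∆ J', C ∈ RS[c] ∧ C ∉ RS[c'] := by
    intro C hC
    rw [hRS, hRS']
    have h1 := fun (h : C ∈ RS[s] ∆ J') => hred h
    rw [Finset.mem_symmDiff] at hC
    rw [Finset.mem_symmDiff, Finset.mem_symmDiff] at h1 ⊢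
    tauto
  have hWNc : WN ⊆ Cz[c] := by
    intro w hw
    rw [hWN, Finset.mem_coe, Finset.mem_biUnion] at hw
    obtain ⟨C, hC, hwC⟩ := hw
    exact (Finset.mem_filter.mp (hN C hC).1).2 hwC
  have hWNc' : WN ⊆ Cz[E₀ \ c'] := by
    intro w hw
    rw [hWN, Finset.mem_coe, Finset.mem_biUnion] at hw
    obtain ⟨C, hC, hwC⟩ := hw
    have hCs : C ∈ Comps[s] := by
      rcases Finset.mem_symmDiff.mp hC with ⟨h, -⟩ | ⟨h, -⟩
      · exact hJ h
      · exact hJ' h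
    have hCc' : C ∈ Comps[c'] := by rw [hComps']; exact hCs
    obtain ⟨hwU, -⟩ := comps_sub ends E₀ z Vf hCc' hwC
    rcases hwU with hwR | hwB
    · exact absurd (Finset.mem_filter.mpr ⟨hCc', comps_subset_red ends E₀ z Vf hTCc' hCc' hwC hwR⟩) (hN C hC).2
    · exact comps_subset_blue ends E₀ z Vf hTCc' hCc' hwC hwB hwC
  -- `c` and `c'` agree off `I[WN]` in the direction we need
  have hJJ : ∀ i, i ∉ I[WN] → (i ∈ I[(↑(J.biUnion id) : Set V)] ↔ i ∈ I[(↑(J'.biUnion id) : Set V)]) := by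
    intro i hi
    rw [mem_incident_biUnion_iff ends E₀ _ rfl, mem_incident_biUnion_iff ends E₀ _ rfl]
    have hi' : ¬ (i ∈ E₀ ∧ ∃ C ∈ J ∆ J', ∃ w ∈ C, w ∈ ends i) := fun h => hi ((mem_incident_biUnion_iff ends E₀ WN hWN).mpr h)
    constructor
    · rintro ⟨hiE, C, hCJ, w, hwC, hwi⟩
      by_cases hCJ' : C ∈ J'
      · exact ⟨hiE, C, hCJ', w, hwC, hwi⟩
      · exact absurd ⟨hiE, C, Finset.mem_symmDiff.mpr (Or.inl ⟨hCJ, hCJ'⟩), w, hwC, hwi⟩ hi'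
    · rintro ⟨hiE, C, hCJ', w, hwC, hwi⟩
      by_cases hCJ : C ∈ J
      · exact ⟨hiE, C, hCJ, w, hwC, hwi⟩
      · exact absurd ⟨hiE, C, Finset.mem_symmDiff.mpr (Or.inr ⟨hCJ', hCJ⟩), w, hwC, hwi⟩ hi'
  have hdiff : ∀ i, i ∉ I[WN] → i ∈ c → i ∈ c' := by
    intro i hi hic
    by_cases hF : i ∈ Fr[s]
    · have h1 : i ∈ c ∩ Fr[s] := Finset.mem_inter.mpr ⟨hic, hF⟩
      rw [hcap] at h1
      have h2 := hfr h1
      rw [← hcap'] at h2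
      exact (Finset.mem_inter.mp h2).1
    · have hiA : i ∉ A := fun h => hF (hA h)
      have hiA' : i ∉ A' := fun h => hF (hA' h)
      have h := hJJ i hi
      rw [hc, Finset.mem_symmDiff, Finset.mem_symmDiff] at hic
      rw [hc', Finset.mem_symmDiff, Finset.mem_symmDiff]
      tauto
  have hIc : ∀ i ∈ c, i ∈ I[WN] → ∃ w, w ∈ WN ∧ w ∈ ends i := fun i _ h => (Finset.mem_filter.mp h).2
  have hIc' : ∀ i ∈ E₀ \ c', i ∈ I[WN] → ∃ w, w ∈ WN ∧ w ∈ ends i := fun i _ h => (Finset.mem_filter.mp h).2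
  have hxc : x ∉ Cz[c] := fun h => hxU (hU ▸ (Or.inl h : x ∈ U[c]))
  have hxc' : x ∉ Cz[E₀ \ c'] := fun h => hxU (hU' ▸ (Or.inr h : x ∈ U[c']))
  refine ⟨?_, ?_, ?_, ?_⟩
  · -- `C_x(c) ⊆ C_x(c \ I[WN]) ⊆ C_x(c')`
    refine (openCluster_subset_sdiff_incident ends c (I[WN]) x z WN hWNc hxc hIc).trans (openCluster_image_mono ends ?_ x)
    intro i hi
    obtain ⟨hic, hiI⟩ := Finset.mem_sdiff.mp hi
    exact hdiff i hiI hic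
  · refine (openCluster_subset_sdiff_incident ends (E₀ \ c') (I[WN]) x z WN hWNc' hxc' hIc').trans (openCluster_image_mono ends ?_ x)
    intro i hi
    obtain ⟨hic', hiI⟩ := Finset.mem_sdiff.mp hi
    obtain ⟨hiE, hic'⟩ := Finset.mem_sdiff.mp hic'
    exact Finset.mem_sdiff.mpr ⟨hiE, fun hic => hic' (hdiff i hiI hic)⟩
  · rw [openCluster_eq_biUnion_side ends E₀ z Vf hVf hcE' hTCc', openCluster_eq_biUnion_side ends E₀ z Vf hVf hcE hTCc,
      Finset.coe_subset]
    refine Finset.insert_subset_insert z (Finset.biUnion_subset_biUnion_of_subset_left _ ?_)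
    rw [hRS, hRS']
    exact hred
  · rw [openCluster_sdiff_eq_biUnion_side ends E₀ z Vf hVf hcE hTCc, openCluster_sdiff_eq_biUnion_side ends E₀ z Vf hVf hcE' hTCc',
      Finset.coe_subset, hRS, hRS', hComps, hComps']
    refine Finset.insert_subset_insert z (Finset.biUnion_subset_biUnion_of_subset_left _ ?_)
    intro C hC
    rw [Finset.mem_sdiff] at hC ⊢
    exact ⟨hC.1, fun h => hC.2 (hred h)⟩

end Coefficientwise

end Summit.CriticalPhenomena.PercolationContinuityZ3.Theorems
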